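import Literature.NumberTheory.LFunctions.WeilPositivityCertificateBlock0
import Literature.NumberTheory.LFunctions.WeilPositivityCertificateBlock1
import HarnessLib

/-!
# Weil positivity at the archimedean place: the discharge of `weilPositivityOn_log_two_half`

Sibling proof file of `Literature/NumberTheory/LFunctions/WeilArchimedeanPositivity.lean`. The
named fact `Literature.weilPositivityOn_log_two_half = WeilPositivityOn ((log 2)/2)` — H. Yoshida,
*On Hermitian forms attached to zeta functions*, Adv. Stud. Pure Math. 21 (1992), **Theorem 1
(p. 310)** restricted to `C(a) ⊆ K(a)`, `a = (log 2)/2`: `⟨φ, φ⟩ = T_Q(φ ∗ φ̃) ≥ 0` — is proved: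

1. `WeilArchimedeanPositivityProofs.lean`: `Q(g) = E(g)` (Yoshida's analytic form (2.1), no
   prime term) and `weilPositivityOn_log_two_half_of_weilArchQuadratic_nonneg`;
2. `WeilPositivityCertificate.lean`: `WeilCert.weilArchQuadratic_nonneg_of_check` — a checked
   certificate implies `E(g) ≥ 0` on `C((log 2)/2)` (moment method: Taylor expansions in the
   polar and critical-line kernels, a certified minorant of `Re ψ(1/4+it/2)`, Plancherel,
   Bessel's inequality, and positivity of two `22 × 22` rational matrices);
3. `WeilPositivityCertificateData.lean`, `…Block0.lean`, `…Block1.lean`: the certificate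
   `weilCert` and the kernel evaluation of the four parts of `weilCert.check`.

As in Yoshida's proof (§6: a `10 × 10` matrix for odd `φ`, a `200 × 200` interval elimination
for even `φ`, "verified rather easily on a computer"), the finite part is a machine computation —
here performed by the Lean kernel.
-/

noncomputable section

namespace Literature.NumberTheory.LFunctions

/-- The certificate passes the checker. [folklore] -/
theorem weilCert_check : weilCert.check = true := by
  unfold WeilCert.check
  rw [checkCells_weilCert, checkScalars_weilCert, checkBlock0_weilCert, checkBlock1_weilCert]
  rfl

/-- Yoshida's analytic form is non-negative on `C((log 2)/2)`. [cite: Yoshida1992, Thm 1 (§6 p. 310) with eq. (2.1)] -/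
theorem weilArchQuadratic_nonneg {g : ℝ → ℂ} (hg : IsWeilTest g)
    (hsupp : tsupport g ⊆ Set.Icc (-(Real.log 2 / 2)) (Real.log 2 / 2)) :
    0 ≤ weilArchQuadratic g :=
  WeilCert.weilArchQuadratic_nonneg_of_check weilCert_check hg hsupp

/-- **Yoshida's Theorem 1 on `C((log 2)/2)`: the named fact `weilPositivityOn_log_two_half`
holds.** [cite: Yoshida1992, Thm 1 (§6 p. 310)] -/
theorem weilPositivityOn_log_two_half_holds : weilPositivityOn_log_two_half :=
  weilPositivityOn_log_two_half_of_weilArchQuadratic_nonneg fun _ hg hsupp ↦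
    weilArchQuadratic_nonneg hg hsupp

end Literature.NumberTheory.LFunctions
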